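import Literature.Probability.LatticeModels.LatticeGreenFunction
import Literature.Probability.LatticeModels.SRWHeatKernel1D
import Mathlib.MeasureTheory.Integral.Pi
import Mathlib.MeasureTheory.Integral.Prod
import Mathlib.Analysis.SpecialFunctions.ImproperIntegrals
import Mathlib.MeasureTheory.Integral.ExpDecay
import HarnessLib

/-!
# The heat-kernel representation of the lattice Green function of `ℤ^d`

Topic `Probability/LatticeModels`, companion of `LatticeGreenFunction.lean` (the Green function
`latticeGreen x = ∫_{[-π,π]^d} cos(p·x)/ε(p) dp/(2π)^d`, `ε(p) = Σᵢ(1 - cos pᵢ)`, `d ≥ 3`) and of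
`SRWHeatKernel1D.lean` (the one-dimensional heat kernel
`srwHeatKernel t m = q_t(m) = (1/2π)∫_{-π}^{π} cos(km)e^{-t(1-cos k)} dk`). PROVED here:

* `setIntegral_cos_mul_exp_eq_prod` — the PRODUCT STRUCTURE of the heat kernel of `ε`:
  `∫_{[-π,π]^d} cos(p·x) e^{-tε(p)} dp = (2π)^d ∏ᵢ q_t(xᵢ)` (the integrand is the real part of
  `∏ᵢ e^{ipᵢxᵢ}e^{-t(1 - cos pᵢ)}`; Fubini over the coordinates);
* `latticeGreen_eq_integral_prod_srwHeatKernel` — **`G(x)/d = latticeGreen x = ∫₀^∞ ∏ᵢ q_t(xᵢ) dt`**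
  for `d ≥ 3`, with the integrability of `t ↦ ∏ᵢ q_t(xᵢ)` on `(0,∞)`: `1/ε(p) = ∫₀^∞ e^{-tε(p)} dt`
  for `p ≠ 0` and Fubini on `[-π,π]^d × (0,∞)`, legitimate because the absolute double integral is
  `∫ dp/ε(p) < ∞` (`integrable_indicator_inv_dispersion`, `d ≥ 3`).

In words: `d · latticeGreen` is the Green function `∫₀^∞ p_t(0,x) dt` of the continuous-time
simple random walk on `ℤ^d` whose coordinates are independent one-dimensional walks (the
time-honoured route to Pólya-type computations); this representation feeds the asymptotics of
`LatticeGreenAsymptotics.lean`.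

## References

* G. F. Lawler, V. Limic, *Random Walk: A Modern Introduction*, CUP 2010, §4.3 (Green function as
  time integral of the heat kernel; continuous-time walk) [LawlerLimic2010].
* T. Hara, Ann. Probab. 36 (2008) 530–593, §2.1 (2.1)–(2.2): the same representation
  `C(x) = ∫₀^∞ I_t(x) dt` for general kernels [Hara2008].
-/

noncomputable section

open MeasureTheory Set Filter
open scoped Real Topology BigOperators

namespace Literature.Probability.LatticeModels

variable {d : ℕ}

/-! ### The product structure of the heat kernel -/

/-- The product of the one-dimensional integrands is `e^{i p·x - tε(p)}`; its real part is
`cos(p·x) e^{-tε(p)}`. [folklore] -/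
theorem prod_srwHeatIntegrand_re (t : ℝ) (x : Site d) (p : Fin d → ℝ) :
    (∏ i, srwHeatIntegrand t (x i) (p i)).re =
      Real.cos (∑ i, p i * (x i : ℝ)) * Real.exp (-(t * dispersion p)) := by
  have hprod : ∏ i, srwHeatIntegrand t (x i) (p i) =
      Complex.exp (∑ i, (Complex.I * (p i : ℂ) * (x i : ℂ) - (t : ℂ) * (1 - Complex.cos (p i)))) := by
    rw [Complex.exp_sum]
    refine Finset.prod_congr rfl fun i _ => ?_
    unfold srwHeatIntegrand
    rw [← Complex.exp_add]
    ring_nf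
  rw [hprod, Complex.exp_re]
  have hre : (∑ i, (Complex.I * (p i : ℂ) * (x i : ℂ) - (t : ℂ) * (1 - Complex.cos (p i)))).re =
      -(t * dispersion p) := by
    rw [Complex.re_sum, dispersion, Finset.mul_sum, ← Finset.sum_neg_distrib]
    refine Finset.sum_congr rfl fun i _ => ?_
    simp [Complex.mul_re, Complex.cos_ofReal_re, Complex.cos_ofReal_im]
  have him : (∑ i, (Complex.I * (p i : ℂ) * (x i : ℂ) - (t : ℂ) * (1 - Complex.cos (p i)))).im =
      ∑ i, p i * (x i : ℝ) := by
    rw [Complex.im_sum]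
    refine Finset.sum_congr rfl fun i _ => ?_
    simp [Complex.mul_im, Complex.cos_ofReal_re, Complex.cos_ofReal_im]
  rw [hre, him, mul_comm]

/-- The complex product integrand is continuous in `p`. [folklore] -/
theorem continuous_prod_srwHeatIntegrand (t : ℝ) (x : Site d) :
    Continuous fun p : Fin d → ℝ => ∏ i, srwHeatIntegrand t (x i) (p i) := by
  refine continuous_finsetProd _ fun i _ => ?_
  exact (differentiable_srwHeatIntegrand t (x i)).continuous.comp
    (Complex.continuous_ofReal.comp (continuous_apply i))

/-- The Brillouin zone as a product of intervals, at the level of measures: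
`vol|_{[-π,π]^d} = ⊗ᵢ vol|_{[-π,π]}`. [folklore] -/
theorem volume_restrict_brillouin (d : ℕ) :
    (volume : Measure (Fin d → ℝ)).restrict (brillouin d) =
      Measure.pi fun _ : Fin d => (volume : Measure ℝ).restrict (Icc (-π) π) := by
  unfold brillouin
  rw [volume_pi, Measure.restrict_pi_pi]

/-- Fubini over the coordinates: `∫_{[-π,π]^d} ∏ᵢ F_{t,xᵢ}(pᵢ) dp = ∏ᵢ 2π q_t(xᵢ)`. [folklore] -/
theorem setIntegral_prod_srwHeatIntegrand (t : ℝ) (x : Site d) :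
    ∫ p in brillouin d, ∏ i, srwHeatIntegrand t (x i) (p i) =
      ∏ i, ((2 * π * srwHeatKernel t (x i) : ℝ) : ℂ) := by
  have hle : (-π : ℝ) ≤ π := by linarith [Real.pi_pos]
  rw [volume_restrict_brillouin,
    integral_fintype_prod_eq_prod (f := fun i (k : ℝ) => srwHeatIntegrand t (x i) k)]
  refine Finset.prod_congr rfl fun i _ => ?_
  rw [← integral_srwHeatIntegrand, intervalIntegral.integral_of_le hle, integral_Icc_eq_integral_Ioc]

/-- **Product structure of the heat kernel of `ε`**:
`∫_{[-π,π]^d} cos(p·x) e^{-tε(p)} dp = (2π)^d ∏ᵢ q_t(xᵢ)`. [folklore] -/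
theorem setIntegral_cos_mul_exp_eq_prod (t : ℝ) (x : Site d) :
    ∫ p in brillouin d, Real.cos (∑ i, p i * (x i : ℝ)) * Real.exp (-(t * dispersion p)) =
      (2 * π) ^ d * ∏ i, srwHeatKernel t (x i) := by
  have hint : Integrable (fun p : Fin d → ℝ => ∏ i, srwHeatIntegrand t (x i) (p i))
      (volume.restrict (brillouin d)) :=
    (continuous_prod_srwHeatIntegrand t x).continuousOn.integrableOn_compact (isCompact_brillouin d)
  have hre := integral_re hint
  simp only [RCLike.re_to_complex] at hre
  simp_rw [prod_srwHeatIntegrand_re] at hre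
  rw [hre, setIntegral_prod_srwHeatIntegrand, ← Complex.ofReal_prod, Complex.ofReal_re,
    Finset.prod_mul_distrib, Finset.prod_const, Finset.card_univ, Fintype.card_fin]

/-! ### The heat-kernel representation -/

/-- `∫₀^∞ e^{-tw} dt = w⁻¹` for `w > 0`, with integrability. [folklore] -/
theorem integral_exp_neg_mul_Ioi' {w : ℝ} (hw : 0 < w) :
    IntegrableOn (fun t : ℝ => Real.exp (-(t * w))) (Ioi 0) ∧
      ∫ t in Ioi (0 : ℝ), Real.exp (-(t * w)) = w⁻¹ := by
  have he : (fun t : ℝ => Real.exp (-(t * w))) = fun t => Real.exp (-w * t) := by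
    funext t; ring_nf
  rw [he]
  refine ⟨exp_neg_integrableOn_Ioi 0 hw, ?_⟩
  rw [integral_exp_mul_Ioi (by linarith : -w < 0)]
  simp [neg_div, div_neg]  -- `-e^0/(-w) = w⁻¹`

/-- **The heat-kernel representation of the lattice Green function** (`d ≥ 3`):
`latticeGreen x = ∫₀^∞ ∏ᵢ q_t(xᵢ) dt`, the integrand being integrable on `(0, ∞)`. Proof:
`1/ε(p) = ∫₀^∞ e^{-tε(p)}dt` for `p ∈ [-π,π]^d ∖ {0}`; Fubini–Tonelli on `[-π,π]^d × (0,∞)` for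
`cos(p·x)e^{-tε(p)}`, dominated by `e^{-tε(p)}` whose double integral is `∫dp/ε(p) < ∞`; then the
product structure `setIntegral_cos_mul_exp_eq_prod`. (The Green function as the time integral of
the continuous-time transition kernel: cf. Lawler–Limic 2010, §4.3; Hara 2008, (2.1).) [folklore] -/
theorem latticeGreen_eq_integral_prod_srwHeatKernel (hd : 3 ≤ d) (x : Site d) :
    IntegrableOn (fun t : ℝ => ∏ i, srwHeatKernel t (x i)) (Ioi 0) ∧
      latticeGreen x = ∫ t in Ioi (0 : ℝ), ∏ i, srwHeatKernel t (x i) := by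
  set μ : Measure (Fin d → ℝ) := volume.restrict (brillouin d) with hμ
  set ν : Measure ℝ := volume.restrict (Ioi (0 : ℝ)) with hν
  set θ : (Fin d → ℝ) → ℝ := fun p => ∑ i, p i * (x i : ℝ) with hθ
  set F : (Fin d → ℝ) × ℝ → ℝ := fun q => Real.cos (θ q.1) * Real.exp (-(q.2 * dispersion q.1)) with hF
  set G : (Fin d → ℝ) × ℝ → ℝ := fun q => Real.exp (-(q.2 * dispersion q.1)) with hG
  have hθc : Continuous θ := by simp only [hθ]; fun_prop
  have hεc : Continuous (dispersion : (Fin d → ℝ) → ℝ) := continuous_dispersion d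
  have hG_cont : Continuous G :=
    Real.continuous_exp.comp ((continuous_snd.mul (hεc.comp continuous_fst)).neg)
  have hF_cont : Continuous F := (Real.continuous_cos.comp (hθc.comp continuous_fst)).mul hG_cont
  have hF_meas : AEStronglyMeasurable F (μ.prod ν) := hF_cont.aestronglyMeasurable
  have hG_meas : AEStronglyMeasurable G (μ.prod ν) := hG_cont.aestronglyMeasurable
  -- `ε > 0` almost everywhere on the Brillouin zone
  have hB : MeasurableSet (brillouin d) := measurableSet_brillouin d
  haveI : Nonempty (Fin d) := ⟨⟨0, by omega⟩⟩
  have hε_pos : ∀ᵐ p ∂μ, 0 < dispersion p := by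
    have h_ne : ∀ᵐ p ∂μ, p ≠ (0 : Fin d → ℝ) := by
      have h0 : μ {(0 : Fin d → ℝ)} = 0 := by
        rw [hμ, Measure.restrict_apply (measurableSet_singleton 0)]
        exact measure_mono_null Set.inter_subset_left (measure_singleton 0)
      filter_upwards [measure_eq_zero_iff_ae_notMem.1 h0] with p hp
      simpa using hp
    filter_upwards [ae_restrict_mem hB, h_ne] with p hp hp0
    exact dispersion_pos_of_mem_brillouin hp hp0
  -- the `t`-integrals for fixed `p`
  have hGp : ∀ p, 0 < dispersion p →
      Integrable (fun t => G (p, t)) ν ∧ ∫ t, G (p, t) ∂ν = (dispersion p)⁻¹ :=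
    fun p hp => integral_exp_neg_mul_Ioi' hp
  -- integrability of `G` on the product: the absolute double integral is `∫ dp/ε(p)`
  have hinv : IntegrableOn (fun p : Fin d → ℝ => (dispersion p)⁻¹) (brillouin d) := by
    have h := (integrable_indicator_iff hB).1 (integrable_indicator_inv_dispersion d hd)
    exact h.congr (Eventually.of_forall fun p => one_div _)
  have hGint : Integrable G (μ.prod ν) := by
    rw [integrable_prod_iff hG_meas]
    refine ⟨?_, ?_⟩
    · filter_upwards [hε_pos] with p hp using (hGp p hp).1
    · refine (hinv.congr ?_)
      filter_upwards [hε_pos] with p hp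
      rw [← (hGp p hp).2]
      refine integral_congr_ae (Eventually.of_forall fun t => ?_)
      simp only [hG, Real.norm_eq_abs, Real.abs_exp]
  have hFint : Integrable F (μ.prod ν) := by
    refine hGint.mono hF_meas (Eventually.of_forall fun q => ?_)
    simp only [hF, hG, Real.norm_eq_abs, abs_mul, Real.abs_exp]
    exact mul_le_of_le_one_left (Real.exp_pos _).le (Real.abs_cos_le_one _)
  -- the inner `p`-integral for fixed `t` is the product of heat kernels
  have hinner : ∀ t : ℝ, ∫ p, F (p, t) ∂μ = (2 * π) ^ d * ∏ i, srwHeatKernel t (x i) := by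
    intro t
    simp only [hF, hθ, hμ]
    exact setIntegral_cos_mul_exp_eq_prod t x
  have h2π : (0 : ℝ) < (2 * π) ^ d := by positivity
  refine ⟨?_, ?_⟩
  · -- integrability of `t ↦ ∏ q_t(xᵢ)`
    have h := hFint.integral_prod_right
    have h' : Integrable (fun t => ((2 * π) ^ d)⁻¹ * ∫ p, F (p, t) ∂μ) ν := h.const_mul _
    refine (h'.congr (Eventually.of_forall fun t => ?_))
    simp only [hinner]
    field_simp
  · -- the representation
    have hG1 : latticeGreen x = (∫ p, ∫ t, F (p, t) ∂ν ∂μ) / (2 * π) ^ d := by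
      unfold latticeGreen
      congr 1
      refine integral_congr_ae ?_
      filter_upwards [hε_pos] with p hp
      simp only [hF]
      rw [integral_const_mul, (hGp p hp).2, div_eq_mul_inv]
    rw [hG1, integral_integral_swap hFint]
    simp_rw [hinner]
    rw [integral_const_mul]
    field_simp

end Literature.Probability.LatticeModels
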